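import Literature.Topology.FourManifolds.KhAntiBigonD
import Literature.Topology.FourManifolds.KhBigonStates
import HarnessLib

/-!
# Enhanced states of the anti-parallel bigon: the five blocks of the cancellation

Sibling file of `KhBigonStates.lean`, continuing `KhAntiBigon`, `KhAntiBigonD` in the invariance
programme for the anti-parallel second Reidemeister move `RMove.omega2c` (Khovanov (2000), §5.3;
Bar-Natan (2002), §4.3; Polyak (2010), `Ω2c/Ω2d`). The cube of `G.antiBigon m ε` over the square
of its two new chords `f` (the NEGATIVE one, flipped first) and `g` (the positive one) has the four
corners

* `stA' σ` (both `0`), `stO' σ` (`f` flipped: the old resolution of `stA' σ` with the small circle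
  `O` split off — for anti-parallel strands the oriented corner), `stU' σ` (both `1`: `O` merged
  back) and `stD' σ` (the unoriented resolution, `= C(D)` by `KhAntiBigonD`),

and, writing `X` for the enhanced states over the corners `stA' σ` (`XA'`), the enhanced states of
the bigon are `X ⊕ (X ⊗ {O ↦ X}) ⊕ (X ⊗ {O ↦ 1}) ⊕ X ⊕ C(D)` = `A ⊕ P ⊕ Q ⊕ U ⊕ D` through the
bijections `embO' x o`, `embU' x` and `antiD` — word for word the construction of
`KhBigonStates.lean` (primed names), whose proofs only use the roles of `f`, `g`, `O` recorded in
`KhAntiBigon`. This file constructs the bijection `antiESEquiv` and computes the matrix blocks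
that the Gaussian elimination of `KhGaussElim` needs:

* `incidence_embA_embP'` — **the block `A → P` (split off `O` labelled `X`) is the identity up
  to the Koszul sign**;
* `incidence_embQ_embU'` — **the block `Q → U` (merge `O` labelled `1`) is the identity up to
  the Koszul sign**;
* `incidence_eq_zero_of_label_sideM_ne'` — the block `Q → P` vanishes (old chords do not touch
  `O`); blocks against the direction of the cube vanish
  (`incidence_eq_zero_of_state_true_false`, `KhBigonStates`).

No named fact is introduced.

## References

* M. Khovanov, *A categorification of the Jones polynomial*, Duke Math. J. 101 (2000) 359–426,
  §5.3. [cite: Khovanov2000, §5.3]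
* D. Bar-Natan, *On Khovanov's categorification of the Jones polynomial*, Algebr. Geom. Topol. 2
  (2002) 337–370, §4.3. [cite: BarNatan2002, §4]
* M. Polyak, *Minimal generating sets of Reidemeister moves*, Quantum Topol. 1 (2010), Thm. 1.2.
  [cite: Polyak2010, Thm 1.2]
-/

open Function

noncomputable section

namespace Literature.Topology.FourManifolds

namespace GaussDiagram

variable (G : GaussDiagram) (m : Fin (2 * G.n + 1)) (ε : ℤˣ)

/-- Membership in the small circle is decidable. [folklore] -/
instance instDecidablePredInO' : DecidablePred (G.InO' m ε) := fun _ ↦ by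
  unfold InO'; infer_instance

/-! ## Sectors by the smoothings of the two new chords -/

/-- The old part of a state of the antiBigon. [folklore] -/
def oldOf' (τ : (G.antiBigon m ε).State) : G.State := fun i ↦ τ (G.oldC' m ε i)

/-- The old part of a `antiState`. [folklore] -/
@[simp] theorem oldOf_antiState (σ : G.State) (a b : Bool) :
    G.oldOf' m ε (G.antiState m ε σ a b) = σ := funext fun i ↦ G.antiState_oldC m ε σ a b i

/-- The old part of the all-`0` resolution. [folklore] -/
@[simp] theorem oldOf_stA' (σ : G.State) : G.oldOf' m ε (G.stA' m ε σ) = σ := G.oldOf_antiState m ε σ _ _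
/-- The old part of the resolution with the small circle. [folklore] -/
@[simp] theorem oldOf_stO' (σ : G.State) : G.oldOf' m ε (G.stO' m ε σ) = σ := G.oldOf_antiState m ε σ _ _
/-- The old part of the all-`1` resolution. [folklore] -/
@[simp] theorem oldOf_stU' (σ : G.State) : G.oldOf' m ε (G.stU' m ε σ) = σ := G.oldOf_antiState m ε σ _ _
/-- The old part of the oriented resolution. [folklore] -/
@[simp] theorem oldOf_stD' (σ : G.State) : G.oldOf' m ε (G.stD' m ε σ) = σ := G.oldOf_antiState m ε σ _ _

/-- `f` is `1`-smoothed in the all-`1` resolution. [folklore] -/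
theorem stU_fC' (σ : G.State) : G.stU' m ε σ (G.fC' m ε) = true := by
  unfold stU' fC'; split_ifs <;> simp

/-- `g` is `1`-smoothed in the all-`1` resolution. [folklore] -/
theorem stU_gC' (σ : G.State) : G.stU' m ε σ (G.gC' m ε) = true := by
  unfold stU' gC'; split_ifs <;> simp

/-- `f` is `0`-smoothed in the oriented resolution. [folklore] -/
theorem stD_fC' (σ : G.State) : G.stD' m ε σ (G.fC' m ε) = false := by
  unfold stD' fC' oBitX oBitY; split_ifs with h <;> simp [h]

/-- `g` is `1`-smoothed in the oriented resolution. [folklore] -/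
theorem stD_gC' (σ : G.State) : G.stD' m ε σ (G.gC' m ε) = true := by
  unfold stD' gC' oBitX oBitY; split_ifs with h <;> simp [h]

/-- For `ε = 1`, `f = y` (the negative chord). [folklore] -/
@[simp] theorem fC_one' : G.fC' m 1 = G.bY' m 1 := if_pos rfl
/-- For `ε = -1`, `f = x`. [folklore] -/
@[simp] theorem fC_neg_one' : G.fC' m (-1) = G.bX' m (-1) := if_neg (by decide)
/-- For `ε = 1`, `g = x` (the positive chord). [folklore] -/
@[simp] theorem gC_one' : G.gC' m 1 = G.bX' m 1 := if_pos rfl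
/-- For `ε = -1`, `g = y`. [folklore] -/
@[simp] theorem gC_neg_one' : G.gC' m (-1) = G.bY' m (-1) := if_neg (by decide)

/-- **A state of the antiBigon is determined by its old part and its smoothings of `f` and `g`**:
the four sectors. [folklore] -/
theorem state_eq_of_fC_gC' (τ : (G.antiBigon m ε).State) :
    (τ (G.fC' m ε) = false → τ (G.gC' m ε) = false → τ = G.stA' m ε (G.oldOf' m ε τ)) ∧
    (τ (G.fC' m ε) = true → τ (G.gC' m ε) = false → τ = G.stO' m ε (G.oldOf' m ε τ)) ∧
    (τ (G.fC' m ε) = true → τ (G.gC' m ε) = true → τ = G.stU' m ε (G.oldOf' m ε τ)) ∧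
    (τ (G.fC' m ε) = false → τ (G.gC' m ε) = true → τ = G.stD' m ε (G.oldOf' m ε τ)) := by
  have key : ∀ a b : Bool, τ (G.bX' m ε) = a → τ (G.bY' m ε) = b →
      τ = G.antiState m ε (G.oldOf' m ε τ) a b := by
    rintro a b rfl rfl
    exact G.eq_antiState m ε τ
  unfold stA' stO' stU' stD'
  rcases Int.units_eq_one_or ε with rfl | rfl
  · simp only [fC_one', gC_one', oBitX_one, oBitY_one]
    exact ⟨fun h1 h2 ↦ key _ _ h2 h1, fun h1 h2 ↦ key _ _ h2 h1, fun h1 h2 ↦ key _ _ h2 h1,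
      fun h1 h2 ↦ key _ _ h2 h1⟩
  · simp only [fC_neg_one', gC_neg_one', oBitX_neg_one, oBitY_neg_one]
    exact ⟨fun h1 h2 ↦ key _ _ h1 h2, fun h1 h2 ↦ key _ _ h1 h2, fun h1 h2 ↦ key _ _ h1 h2,
      fun h1 h2 ↦ key _ _ h1 h2⟩

/-! ## The strands of `f` and `g` on and off the small circle -/

/-- The first local strand of `f`. [folklore] -/
def aF' : (G.antiBigon m ε).Arc := (G.antiBigon m ε).arcIn ((G.antiBigon m ε).overPos (G.fC' m ε))

/-- The second local strand of `f`. [folklore] -/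
def bF' : (G.antiBigon m ε).Arc := (G.antiBigon m ε).arcOut ((G.antiBigon m ε).overPos (G.fC' m ε))

/-- The first local strand of `g`. [folklore] -/
def aG' : (G.antiBigon m ε).Arc := (G.antiBigon m ε).arcIn ((G.antiBigon m ε).overPos (G.gC' m ε))

/-- The second local strand of `g`. [folklore] -/
def bG' : (G.antiBigon m ε).Arc := (G.antiBigon m ε).arcOut ((G.antiBigon m ε).overPos (G.gC' m ε))

/-- **The strand of `f` off the small circle** (the one of the two local strands of `f` which is
not a side of the antiBigon). [folklore] -/
def cF' : (G.antiBigon m ε).Arc := if G.InO' m ε (G.aF' m ε) then G.bF' m ε else G.aF' m ε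

/-- **The strand of `g` off the small circle.** [folklore] -/
def cG' : (G.antiBigon m ε).Arc := if G.InO' m ε (G.aG' m ε) then G.bG' m ε else G.aG' m ε

/-- Exactly one local strand of `f` is a side of the antiBigon. [folklore] -/
theorem inO_aF_bF' :
    (¬ G.InO' m ε (G.aF' m ε) ∧ G.InO' m ε (G.bF' m ε)) ∨
      (G.InO' m ε (G.aF' m ε) ∧ ¬ G.InO' m ε (G.bF' m ε)) :=
  G.inO_strands_fC' m ε

/-- Exactly one local strand of `g` is a side of the antiBigon. [folklore] -/
theorem inO_aG_bG' :
    (¬ G.InO' m ε (G.aG' m ε) ∧ G.InO' m ε (G.bG' m ε)) ∨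
      (G.InO' m ε (G.aG' m ε) ∧ ¬ G.InO' m ε (G.bG' m ε)) :=
  G.inO_strands_gC' m ε

/-- The strand of `f` off the small circle is off the small circle. [folklore] -/
theorem not_inO_cF' : ¬ G.InO' m ε (G.cF' m ε) := by
  unfold cF'
  rcases G.inO_aF_bF' m ε with ⟨ha, hb⟩ | ⟨ha, hb⟩
  · rw [if_neg ha]; exact ha
  · rw [if_pos ha]; exact hb

/-- The strand of `g` off the small circle is off the small circle. [folklore] -/
theorem not_inO_cG' : ¬ G.InO' m ε (G.cG' m ε) := by
  unfold cG'
  rcases G.inO_aG_bG' m ε with ⟨ha, hb⟩ | ⟨ha, hb⟩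
  · rw [if_neg ha]; exact ha
  · rw [if_pos ha]; exact hb

variable (σ : G.State)

/-- In the resolution with the small circle, two sides of the antiBigon lie on one circle, and an
arc on the circle of a side is a side. [folklore] -/
theorem circleOf_stO_eq_of_inO' {u v : (G.antiBigon m ε).Arc} (hu : G.InO' m ε u) :
    (G.antiBigon m ε).circleOf (G.stO' m ε σ) v = (G.antiBigon m ε).circleOf (G.stO' m ε σ) u ↔
      G.InO' m ε v := by
  rw [(G.circleOf_stO_eq_iff' m ε σ u).2 hu, circleOf_stO_eq_iff']

/-- In the all-`0` resolution the two local strands of `f` lie on one circle (the circle which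
splits). [folklore] -/
theorem circleOf_stA_aF_eq_bF' :
    (G.antiBigon m ε).circleOf (G.stA' m ε σ) (G.aF' m ε) =
      (G.antiBigon m ε).circleOf (G.stA' m ε σ) (G.bF' m ε) :=
  circleOf_eq_iff.2 (G.isSplitAt_stA' m ε σ).reachable

/-- Circles of the resolution with the small circle refine those of the all-`0` resolution (the
flip of `f` is a split). [folklore] -/
theorem circleOf_stA_eq_of_stO_eq' {u v : (G.antiBigon m ε).Arc}
    (h : (G.antiBigon m ε).circleOf (G.stO' m ε σ) u = (G.antiBigon m ε).circleOf (G.stO' m ε σ) v) :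
    (G.antiBigon m ε).circleOf (G.stA' m ε σ) u = (G.antiBigon m ε).circleOf (G.stA' m ε σ) v := by
  rw [circleOf_eq_iff] at h ⊢
  rw [← update_stA_fC'] at h
  exact (G.isSplitAt_stA' m ε σ).reachable_of_reachable_update h

/-- In the all-`0` resolution, a side of the antiBigon lies on the circle of the strands of `f`.
[folklore] -/
theorem circleOf_stA_eq_aF_of_inO' {u : (G.antiBigon m ε).Arc} (hu : G.InO' m ε u) :
    (G.antiBigon m ε).circleOf (G.stA' m ε σ) u = (G.antiBigon m ε).circleOf (G.stA' m ε σ) (G.aF' m ε) := by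
  rcases G.inO_aF_bF' m ε with ⟨-, hb⟩ | ⟨ha, -⟩
  · rw [circleOf_stA_aF_eq_bF']
    exact G.circleOf_stA_eq_of_stO_eq' m ε σ ((G.circleOf_stO_eq_of_inO' m ε σ hb).2 hu)
  · exact G.circleOf_stA_eq_of_stO_eq' m ε σ ((G.circleOf_stO_eq_of_inO' m ε σ ha).2 hu)

/-- In the all-`0` resolution, the strand of `f` off the small circle lies on the circle of the
strands of `f`. [folklore] -/
theorem circleOf_stA_cF' :
    (G.antiBigon m ε).circleOf (G.stA' m ε σ) (G.cF' m ε) =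
      (G.antiBigon m ε).circleOf (G.stA' m ε σ) (G.aF' m ε) := by
  unfold cF'; split_ifs
  · exact (G.circleOf_stA_aF_eq_bF' m ε σ).symm
  · rfl

/-- Circles of the resolution with the small circle are contained in circles of the all-`1`
resolution (the flip of `g` is a merge). [folklore] -/
theorem circleOf_stU_eq_of_stO_eq' {u v : (G.antiBigon m ε).Arc}
    (h : (G.antiBigon m ε).circleOf (G.stO' m ε σ) u = (G.antiBigon m ε).circleOf (G.stO' m ε σ) v) :
    (G.antiBigon m ε).circleOf (G.stU' m ε σ) u = (G.antiBigon m ε).circleOf (G.stU' m ε σ) v := by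
  rw [circleOf_eq_iff] at h ⊢
  rw [← update_stO_gC']
  exact (G.isMergeAt_stO' m ε σ).reachable_update_of_reachable h

/-- In the all-`1` resolution the two local strands of `g` lie on one circle (the merged one).
[folklore] -/
theorem circleOf_stU_aG_eq_bG' :
    (G.antiBigon m ε).circleOf (G.stU' m ε σ) (G.aG' m ε) =
      (G.antiBigon m ε).circleOf (G.stU' m ε σ) (G.bG' m ε) := by
  rw [circleOf_eq_iff, ← update_stO_gC']
  exact (G.isMergeAt_stO' m ε σ).reachable_update

/-- In the all-`1` resolution, a side of the antiBigon lies on the merged circle. [folklore] -/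
theorem circleOf_stU_eq_aG_of_inO' {u : (G.antiBigon m ε).Arc} (hu : G.InO' m ε u) :
    (G.antiBigon m ε).circleOf (G.stU' m ε σ) u = (G.antiBigon m ε).circleOf (G.stU' m ε σ) (G.aG' m ε) := by
  rcases G.inO_aG_bG' m ε with ⟨-, hb⟩ | ⟨ha, -⟩
  · rw [circleOf_stU_aG_eq_bG']
    exact G.circleOf_stU_eq_of_stO_eq' m ε σ ((G.circleOf_stO_eq_of_inO' m ε σ hb).2 hu)
  · exact G.circleOf_stU_eq_of_stO_eq' m ε σ ((G.circleOf_stO_eq_of_inO' m ε σ ha).2 hu)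

/-- In the all-`1` resolution, the strand of `g` off the small circle lies on the merged circle.
[folklore] -/
theorem circleOf_stU_cG' :
    (G.antiBigon m ε).circleOf (G.stU' m ε σ) (G.cG' m ε) =
      (G.antiBigon m ε).circleOf (G.stU' m ε σ) (G.aG' m ε) := by
  unfold cG'; split_ifs
  · exact (G.circleOf_stU_aG_eq_bG' m ε σ).symm
  · rfl

/-- In the resolution with the small circle, an arc on the circle of the strand of `g` off the
small circle is off the small circle. [folklore] -/
theorem not_inO_of_circleOf_stO_eq_cG' {u : (G.antiBigon m ε).Arc}
    (h : (G.antiBigon m ε).circleOf (G.stO' m ε σ) u = (G.antiBigon m ε).circleOf (G.stO' m ε σ) (G.cG' m ε)) :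
    ¬ G.InO' m ε u := fun hu ↦
  G.not_inO_cG' m ε ((G.circleOf_stO_eq_of_inO' m ε σ hu).1 h.symm)

/-! ## The `A`-sector and the embeddings of the five sectors -/

/-- **The `A`-sector**: the enhanced states of the antiBigon over the all-`0` resolutions of the two
new chords. This finite type indexes each of the four sectors `A`, `P`, `Q`, `U` of the
cancellation. Khovanov (2000), §5.3. [cite: Khovanov2000, §5.3] -/
def XA' : Type :=
  {t : (G.antiBigon m ε).EnhancedState // t.state (G.fC' m ε) = false ∧ t.state (G.gC' m ε) = false}

/-- The `A`-sector is a finite type. [folklore] -/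
instance instFintypeXA' : Fintype (G.XA' m ε) := by unfold XA'; infer_instance
/-- The `A`-sector has decidable equality. [folklore] -/
instance instDecidableEqXA' : DecidableEq (G.XA' m ε) := by unfold XA'; infer_instance

variable {G m ε} {σ}

/-- The state of an element of the `A`-sector. [folklore] -/
theorem XA'.state_eq (x : G.XA' m ε) : x.1.state = G.stA' m ε (G.oldOf' m ε x.1.state) :=
  (G.state_eq_of_fC_gC' m ε x.1.state).1 x.2.1 x.2.2

/-- Two sides of the antiBigon carry the same label in an enhanced state over the resolution with the
small circle. [folklore] -/
theorem label_eq_of_inO' {t : (G.antiBigon m ε).EnhancedState} {σ : G.State} (ht : t.state = G.stO' m ε σ)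
    {u v : (G.antiBigon m ε).Arc} (hu : G.InO' m ε u) (hv : G.InO' m ε v) : t.label u = t.label v :=
  t.label_eq_of_circleOf_eq (by rw [ht]; exact ((G.circleOf_stO_eq_of_inO' m ε σ hv).2 hu))

/-- **The sectors `P` (`o = X`) and `Q` (`o = 1`)**: push an element of the `A`-sector across the
split at `f`, labelling the small circle by `o`. Khovanov (2000), §5.3. [cite: Khovanov2000, §5.3] -/
def embO' (x : G.XA' m ε) (o : Bool) : (G.antiBigon m ε).EnhancedState :=
  (G.isSplitAt_stA' m ε (G.oldOf' m ε x.1.state)).push (x.1.lab x.state_eq)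
    (if G.InO' m ε (G.aF' m ε) then o else x.1.label (G.aF' m ε))
    (if G.InO' m ε (G.aF' m ε) then x.1.label (G.aF' m ε) else o)

/-- The state of `embO' x o`. [folklore] -/
@[simp] theorem embO_state' (x : G.XA' m ε) (o : Bool) :
    (embO' x o).state = G.stO' m ε (G.oldOf' m ε x.1.state) := by
  unfold embO'
  rw [IsSplitAt.push_state, update_stA_fC']

/-- **`embO' x o` labels the small circle by `o`.** [folklore] -/
theorem embO_label_of_inO' (x : G.XA' m ε) (o : Bool) {u : (G.antiBigon m ε).Arc} (hu : G.InO' m ε u) :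
    (embO' x o).label u = o := by
  unfold embO'
  rw [IsSplitAt.push_label, update_stA_fC']
  rcases G.inO_aF_bF' m ε with ⟨ha, hb⟩ | ⟨ha, hb⟩
  · rw [if_neg ha, if_neg ha, if_neg, if_pos]
    · exact (G.circleOf_stO_eq_of_inO' m ε _ hb).2 hu
    · exact fun h ↦ ha ((G.circleOf_stO_eq_of_inO' m ε _ hu).1 h.symm)
  · rw [if_pos ha, if_pos]
    exact (G.circleOf_stO_eq_of_inO' m ε _ ha).2 hu

/-- **`embO' x o` has the labels of `x` off the small circle.** [folklore] -/
theorem embO_label_of_not_inO' (x : G.XA' m ε) (o : Bool) {u : (G.antiBigon m ε).Arc}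
    (hu : ¬ G.InO' m ε u) : (embO' x o).label u = x.1.label u := by
  unfold embO'
  rw [IsSplitAt.push_label, update_stA_fC']
  simp only [EnhancedState.lab_val]
  set σ := G.oldOf' m ε x.1.state
  have hx : x.1.state = G.stA' m ε σ := x.state_eq
  -- an arc on the `stO'`-circle of a strand of `f` lies on the split circle of `stA'`
  have lab : ∀ w : (G.antiBigon m ε).Arc, (G.antiBigon m ε).circleOf (G.stO' m ε σ) u =
      (G.antiBigon m ε).circleOf (G.stO' m ε σ) w → (w = G.aF' m ε ∨ w = G.bF' m ε) →
      x.1.label (G.aF' m ε) = x.1.label u := by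
    intro w hw hw'
    apply x.1.label_eq_of_circleOf_eq
    rw [hx]
    have h1 := G.circleOf_stA_eq_of_stO_eq' m ε σ hw
    rcases hw' with rfl | rfl
    · exact h1.symm
    · rw [h1, circleOf_stA_aF_eq_bF']
  rcases G.inO_aF_bF' m ε with ⟨ha, hb⟩ | ⟨ha, hb⟩
  · rw [if_neg ha, if_neg ha]
    split_ifs with h1 h2
    · exact lab _ h1 (Or.inl rfl)
    · exact (hu ((G.circleOf_stO_eq_of_inO' m ε σ hb).1 h2)).elim
    · rfl
  · rw [if_pos ha, if_pos ha]
    split_ifs with h1 h2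
    · exact (hu ((G.circleOf_stO_eq_of_inO' m ε σ ha).1 h1)).elim
    · exact lab _ h2 (Or.inr rfl)
    · rfl

/-- The label of `embO' x o` at `sideM'` is `o`. [folklore] -/
@[simp] theorem embO_label_sideM' (x : G.XA' m ε) (o : Bool) : (embO' x o).label (G.sideM' m ε) = o :=
  embO_label_of_inO' x o (G.inO_sideM' m ε)

/-- `embO' x o` determines `x`. [folklore] -/
theorem embO_injective' (o : Bool) : Injective (fun x : G.XA' m ε ↦ embO' x o) := by
  intro x x' h
  dsimp only at h
  have hσ : G.oldOf' m ε x.1.state = G.oldOf' m ε x'.1.state := by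
    have := congrArg EnhancedState.state h
    rw [embO_state', embO_state'] at this
    exact (G.antiState_inj m ε this).1
  apply Subtype.ext
  refine EnhancedState.ext' (by rw [x.state_eq, x'.state_eq, hσ]) (funext fun u ↦ ?_)
  by_cases hu : G.InO' m ε u
  · -- on the small circle: both labels are the label of the strand off it
    have e1 : x.1.label u = x.1.label (G.cF' m ε) := x.1.label_eq_of_circleOf_eq (by
      rw [x.state_eq, circleOf_stA_cF']; exact G.circleOf_stA_eq_aF_of_inO' m ε _ hu)
    have e2 : x'.1.label u = x'.1.label (G.cF' m ε) := x'.1.label_eq_of_circleOf_eq (by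
      rw [x'.state_eq, circleOf_stA_cF']; exact G.circleOf_stA_eq_aF_of_inO' m ε _ hu)
    rw [e1, e2, ← embO_label_of_not_inO' x o (G.not_inO_cF' m ε),
      ← embO_label_of_not_inO' x' o (G.not_inO_cF' m ε), h]
  · rw [← embO_label_of_not_inO' x o hu, ← embO_label_of_not_inO' x' o hu, h]

/-- **The sector `U`**: push `embO' x 1` across the merge at `g`, the merged circle taking the
label of the strand of `g` off the small circle. Khovanov (2000), §5.3. [cite: Khovanov2000, §5.3] -/
def embU' (x : G.XA' m ε) : (G.antiBigon m ε).EnhancedState :=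
  (G.isMergeAt_stO' m ε (G.oldOf' m ε x.1.state)).push ((embO' x false).lab (embO_state' x false))
    (x.1.label (G.cG' m ε))

/-- The state of `embU' x`. [folklore] -/
@[simp] theorem embU_state' (x : G.XA' m ε) : (embU' x).state = G.stU' m ε (G.oldOf' m ε x.1.state) := by
  unfold embU'
  rw [IsMergeAt.push_state, update_stO_gC']

/-- The labels of `embU' x`: the label of `x` at the strand of `g` off the small circle on the
merged circle, the labels of `embO' x 1` elsewhere. [folklore] -/
theorem embU_label' (x : G.XA' m ε) (u : (G.antiBigon m ε).Arc) :
    (embU' x).label u =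
      if (G.antiBigon m ε).circleOf (G.stU' m ε (G.oldOf' m ε x.1.state)) u =
          (G.antiBigon m ε).circleOf (G.stU' m ε (G.oldOf' m ε x.1.state)) (G.aG' m ε)
      then x.1.label (G.cG' m ε) else (embO' x false).label u := by
  unfold embU'
  rw [IsMergeAt.push_label, update_stO_gC']
  rfl

/-- **Off the merged circle `embU' x` has the labels of `x`**, and so it has on the merged circle
at arcs off the small circle. [folklore] -/
theorem embU_label_of_not_inO' (x : G.XA' m ε) {u : (G.antiBigon m ε).Arc} (hu : ¬ G.InO' m ε u) :
    (embU' x).label u = x.1.label u := by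
  rw [embU_label']
  split_ifs with h
  · -- `u` on the merged circle, off `O`: `u` and `cG'` lie on one circle of `stO'`, hence of `stA'`
    set σ := G.oldOf' m ε x.1.state
    apply x.1.label_eq_of_circleOf_eq
    rw [x.state_eq]
    apply G.circleOf_stA_eq_of_stO_eq' m ε σ
    rw [circleOf_eq_iff] at h ⊢
    rw [← update_stO_gC'] at h
    have key := (G.isMergeAt_stO' m ε σ).reachable_update_iff u (G.aG' m ε)
    rw [key] at h
    -- `MergedReach`: `u ~ aG'`, or `u ~ aG' ∧ bG' ~ aG'`, or `u ~ bG' ∧ aG' ~ aG'`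
    have hcG : ∀ w, (w = G.aG' m ε ∨ w = G.bG' m ε) →
        ((G.antiBigon m ε).stateGraph (G.stO' m ε σ)).Reachable u w →
        ((G.antiBigon m ε).stateGraph (G.stO' m ε σ)).Reachable (G.cG' m ε) w := by
      intro w hw huw
      unfold cG'
      rcases G.inO_aG_bG' m ε with ⟨ha, hb⟩ | ⟨ha, hb⟩
      · rw [if_neg ha]
        rcases hw with rfl | rfl
        · rfl
        · exact (hu ((G.circleOf_stO_eq_of_inO' m ε σ hb).1 (circleOf_eq_iff.2 huw))).elim
      · rw [if_pos ha]
        rcases hw with rfl | rfl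
        · exact (hu ((G.circleOf_stO_eq_of_inO' m ε σ ha).1 (circleOf_eq_iff.2 huw))).elim
        · rfl
    rcases h with h | ⟨h, -⟩ | ⟨h, -⟩
    · exact (h.trans (hcG _ (Or.inl rfl) h).symm).symm
    · exact (h.trans (hcG _ (Or.inl rfl) h).symm).symm
    · exact (h.trans (hcG _ (Or.inr rfl) h).symm).symm
  · exact embO_label_of_not_inO' x false hu

/-- **On the merged circle `embU' x` has the label of `x` at the strand of `g` off the small
circle**; in particular on the small circle. [folklore] -/
theorem embU_label_of_inO' (x : G.XA' m ε) {u : (G.antiBigon m ε).Arc} (hu : G.InO' m ε u) :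
    (embU' x).label u = x.1.label (G.cG' m ε) := by
  rw [embU_label', if_pos (G.circleOf_stU_eq_aG_of_inO' m ε _ hu)]

/-- The label of `embU' x` at the first strand of `g`. [folklore] -/
theorem embU_label_aG' (x : G.XA' m ε) : (embU' x).label (G.aG' m ε) = x.1.label (G.cG' m ε) := by
  rw [embU_label', if_pos rfl]

/-- `embU'` is injective. [folklore] -/
theorem embU_injective' : Injective (embU' (G := G) (m := m) (ε := ε)) := by
  intro x x' h
  have hσ : G.oldOf' m ε x.1.state = G.oldOf' m ε x'.1.state := by
    have := congrArg EnhancedState.state h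
    rw [embU_state', embU_state'] at this
    exact (G.antiState_inj m ε this).1
  apply Subtype.ext
  refine EnhancedState.ext' (by rw [x.state_eq, x'.state_eq, hσ]) (funext fun u ↦ ?_)
  by_cases hu : G.InO' m ε u
  · have e1 : x.1.label u = x.1.label (G.cF' m ε) := x.1.label_eq_of_circleOf_eq (by
      rw [x.state_eq, circleOf_stA_cF']; exact G.circleOf_stA_eq_aF_of_inO' m ε _ hu)
    have e2 : x'.1.label u = x'.1.label (G.cF' m ε) := x'.1.label_eq_of_circleOf_eq (by
      rw [x'.state_eq, circleOf_stA_cF']; exact G.circleOf_stA_eq_aF_of_inO' m ε _ hu)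
    rw [e1, e2, ← embU_label_of_not_inO' x (G.not_inO_cF' m ε),
      ← embU_label_of_not_inO' x' (G.not_inO_cF' m ε), h]
  · rw [← embU_label_of_not_inO' x hu, ← embU_label_of_not_inO' x' hu, h]

/-! ## Pulling back to the `A`-sector -/

/-- **Pull an enhanced state over a resolution with the small circle back to the `A`-sector**
(the split circle takes the label of the strand of `f` off the small circle). [folklore] -/
def pullA' (t : (G.antiBigon m ε).EnhancedState)
    (ht : t.state (G.fC' m ε) = true ∧ t.state (G.gC' m ε) = false) : G.XA' m ε :=
  ⟨(G.isSplitAt_stA' m ε (G.oldOf' m ε t.state)).pull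
      (t.lab (((G.state_eq_of_fC_gC' m ε t.state).2.1 ht.1 ht.2).trans
        (G.update_stA_fC' m ε _).symm))
      (t.label (G.cF' m ε)),
    by simp only [IsSplitAt.pull_state]; exact ⟨G.stA_fC' m ε _, G.stA_gC' m ε _⟩⟩

/-- The state of `pullA' t`. [folklore] -/
@[simp] theorem pullA_state' (t : (G.antiBigon m ε).EnhancedState)
    (ht : t.state (G.fC' m ε) = true ∧ t.state (G.gC' m ε) = false) :
    (pullA' t ht).1.state = G.stA' m ε (G.oldOf' m ε t.state) := rfl

/-- **`pullA' t` has the labels of `t` off the small circle.** [folklore] -/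
theorem pullA_label_of_not_inO' (t : (G.antiBigon m ε).EnhancedState)
    (ht : t.state (G.fC' m ε) = true ∧ t.state (G.gC' m ε) = false) {u : (G.antiBigon m ε).Arc}
    (hu : ¬ G.InO' m ε u) : (pullA' t ht).1.label u = t.label u := by
  have hst : t.state = G.stO' m ε (G.oldOf' m ε t.state) :=
    (G.state_eq_of_fC_gC' m ε t.state).2.1 ht.1 ht.2
  show ((G.isSplitAt_stA' m ε (G.oldOf' m ε t.state)).pull _ _).label u = _
  rw [IsSplitAt.pull_label]
  split_ifs with h
  · -- `u` on the split circle, off `O`: `u` and `cF'` lie on one circle of `stO'`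
    apply t.label_eq_of_circleOf_eq
    rw [hst]
    set σ := G.oldOf' m ε t.state
    rw [circleOf_eq_iff, ← update_stA_fC']
    rw [circleOf_eq_iff] at h
    have key := ((G.isSplitAt_stA' m ε σ).reachable_iff u (G.aF' m ε)).1 h
    rw [update_stA_fC'] at key ⊢
    have hcF : ∀ w, (w = G.aF' m ε ∨ w = G.bF' m ε) →
        ((G.antiBigon m ε).stateGraph (G.stO' m ε σ)).Reachable u w →
        ((G.antiBigon m ε).stateGraph (G.stO' m ε σ)).Reachable (G.cF' m ε) w := by
      intro w hw huw
      unfold cF'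
      rcases G.inO_aF_bF' m ε with ⟨ha, hb⟩ | ⟨ha, hb⟩
      · rw [if_neg ha]
        rcases hw with rfl | rfl
        · rfl
        · exact (hu ((G.circleOf_stO_eq_of_inO' m ε σ hb).1 (circleOf_eq_iff.2 huw))).elim
      · rw [if_pos ha]
        rcases hw with rfl | rfl
        · exact (hu ((G.circleOf_stO_eq_of_inO' m ε σ ha).1 (circleOf_eq_iff.2 huw))).elim
        · rfl
    rcases key with h | ⟨h, -⟩ | ⟨h, -⟩
    · exact (h.trans (hcF _ (Or.inl rfl) h).symm).symm
    · exact (h.trans (hcF _ (Or.inl rfl) h).symm).symm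
    · exact (h.trans (hcF _ (Or.inr rfl) h).symm).symm
  · rfl

/-- **`pullA' t` has the label of `t` at the strand of `f` off the small circle, on the small
circle.** [folklore] -/
theorem pullA_label_of_inO' (t : (G.antiBigon m ε).EnhancedState)
    (ht : t.state (G.fC' m ε) = true ∧ t.state (G.gC' m ε) = false) {u : (G.antiBigon m ε).Arc}
    (hu : G.InO' m ε u) : (pullA' t ht).1.label u = t.label (G.cF' m ε) := by
  show ((G.isSplitAt_stA' m ε (G.oldOf' m ε t.state)).pull _ _).label u = _
  rw [IsSplitAt.pull_label]
  exact if_pos (G.circleOf_stA_eq_aF_of_inO' m ε _ hu)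

/-- **Push after pull**: an enhanced state over a resolution with the small circle is `embO'` of
its pull-back, with its own label on the small circle. [folklore] -/
theorem embO_pullA' (t : (G.antiBigon m ε).EnhancedState)
    (ht : t.state (G.fC' m ε) = true ∧ t.state (G.gC' m ε) = false) :
    embO' (pullA' t ht) (t.label (G.sideM' m ε)) = t := by
  have hst : t.state = G.stO' m ε (G.oldOf' m ε t.state) :=
    (G.state_eq_of_fC_gC' m ε t.state).2.1 ht.1 ht.2
  refine EnhancedState.ext' (by rw [embO_state', pullA_state', oldOf_stA', ← hst]) (funext fun u ↦ ?_)
  by_cases hu : G.InO' m ε u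
  · rw [embO_label_of_inO' _ _ hu]
    exact label_eq_of_inO' hst (G.inO_sideM' m ε) hu
  · rw [embO_label_of_not_inO' _ _ hu, pullA_label_of_not_inO' t ht hu]

/-- **Pull after push**: `pullA' (embO' x o) = x`. [folklore] -/
theorem pullA_embO' (x : G.XA' m ε) (o : Bool)
    (h : (embO' x o).state (G.fC' m ε) = true ∧ (embO' x o).state (G.gC' m ε) = false) :
    pullA' (embO' x o) h = x := by
  apply Subtype.ext
  refine EnhancedState.ext' ?_ (funext fun u ↦ ?_)
  · rw [pullA_state', embO_state', oldOf_stO', ← x.state_eq]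
  · by_cases hu : G.InO' m ε u
    · rw [pullA_label_of_inO' _ h hu, embO_label_of_not_inO' x o (G.not_inO_cF' m ε)]
      apply x.1.label_eq_of_circleOf_eq
      rw [x.state_eq, circleOf_stA_cF']
      exact (G.circleOf_stA_eq_aF_of_inO' m ε _ hu).symm
    · rw [pullA_label_of_not_inO' _ h hu, embO_label_of_not_inO' x o hu]

/-- The sector conditions of a pushed state. [folklore] -/
theorem embO_fC_gC' (x : G.XA' m ε) (o : Bool) :
    (embO' x o).state (G.fC' m ε) = true ∧ (embO' x o).state (G.gC' m ε) = false := by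
  rw [embO_state']
  exact ⟨G.stO_fC' m ε _, G.stO_gC' m ε _⟩

/-- **Pull an enhanced state over an all-`1` resolution back across the merge at `g`**, the small
circle taking the label `1` and the other circle the label of the merged circle. [folklore] -/
def pullU' (t : (G.antiBigon m ε).EnhancedState)
    (ht : t.state (G.fC' m ε) = true ∧ t.state (G.gC' m ε) = true) : (G.antiBigon m ε).EnhancedState :=
  (G.isMergeAt_stO' m ε (G.oldOf' m ε t.state)).pull
    (t.lab (((G.state_eq_of_fC_gC' m ε t.state).2.2.1 ht.1 ht.2).trans (G.update_stO_gC' m ε _).symm))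
    (if G.InO' m ε (G.aG' m ε) then false else t.label (G.aG' m ε))
    (if G.InO' m ε (G.aG' m ε) then t.label (G.aG' m ε) else false)

/-- The state of `pullU' t`. [folklore] -/
@[simp] theorem pullU_state' (t : (G.antiBigon m ε).EnhancedState)
    (ht : t.state (G.fC' m ε) = true ∧ t.state (G.gC' m ε) = true) :
    (pullU' t ht).state = G.stO' m ε (G.oldOf' m ε t.state) := rfl

/-- **`pullU' t` labels the small circle by `1`.** [folklore] -/
theorem pullU_label_of_inO' (t : (G.antiBigon m ε).EnhancedState)
    (ht : t.state (G.fC' m ε) = true ∧ t.state (G.gC' m ε) = true) {u : (G.antiBigon m ε).Arc}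
    (hu : G.InO' m ε u) : (pullU' t ht).label u = false := by
  unfold pullU'
  rw [IsMergeAt.pull_label]
  set σ := G.oldOf' m ε t.state
  rcases G.inO_aG_bG' m ε with ⟨ha, hb⟩ | ⟨ha, hb⟩
  · rw [if_neg ha, if_neg ha, if_neg, if_pos]
    · exact (G.circleOf_stO_eq_of_inO' m ε _ hb).2 hu
    · exact fun h ↦ ha ((G.circleOf_stO_eq_of_inO' m ε _ hu).1 h.symm)
  · rw [if_pos ha, if_pos]
    exact (G.circleOf_stO_eq_of_inO' m ε _ ha).2 hu

/-- **`pullU' t` has the labels of `t` off the small circle.** [folklore] -/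
theorem pullU_label_of_not_inO' (t : (G.antiBigon m ε).EnhancedState)
    (ht : t.state (G.fC' m ε) = true ∧ t.state (G.gC' m ε) = true) {u : (G.antiBigon m ε).Arc}
    (hu : ¬ G.InO' m ε u) : (pullU' t ht).label u = t.label u := by
  have hst : t.state = G.stU' m ε (G.oldOf' m ε t.state) :=
    (G.state_eq_of_fC_gC' m ε t.state).2.2.1 ht.1 ht.2
  unfold pullU'
  rw [IsMergeAt.pull_label]
  simp only [EnhancedState.lab_val]
  set σ := G.oldOf' m ε t.state
  -- an arc on the `stO'`-circle of a strand of `g` has, in `t`, the label of that strand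
  have lab : ∀ w : (G.antiBigon m ε).Arc, (G.antiBigon m ε).circleOf (G.stO' m ε σ) u =
      (G.antiBigon m ε).circleOf (G.stO' m ε σ) w → (w = G.aG' m ε ∨ w = G.bG' m ε) →
      t.label (G.aG' m ε) = t.label u := by
    intro w hw hw'
    apply t.label_eq_of_circleOf_eq
    rw [hst]
    have h1 := G.circleOf_stU_eq_of_stO_eq' m ε σ hw
    rcases hw' with rfl | rfl
    · exact h1.symm
    · rw [h1, circleOf_stU_aG_eq_bG']
  rcases G.inO_aG_bG' m ε with ⟨ha, hb⟩ | ⟨ha, hb⟩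
  · rw [if_neg ha, if_neg ha]
    split_ifs with h1 h2
    · exact lab _ h1 (Or.inl rfl)
    · exact (hu ((G.circleOf_stO_eq_of_inO' m ε σ hb).1 h2)).elim
    · rfl
  · rw [if_pos ha, if_pos ha]
    split_ifs with h1 h2
    · exact (hu ((G.circleOf_stO_eq_of_inO' m ε σ ha).1 h1)).elim
    · exact lab _ h2 (Or.inr rfl)
    · rfl

/-- The sector conditions of `pullU' t`. [folklore] -/
theorem pullU_fC_gC' (t : (G.antiBigon m ε).EnhancedState)
    (ht : t.state (G.fC' m ε) = true ∧ t.state (G.gC' m ε) = true) :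
    (pullU' t ht).state (G.fC' m ε) = true ∧ (pullU' t ht).state (G.gC' m ε) = false := by
  rw [pullU_state']
  exact ⟨G.stO_fC' m ε _, G.stO_gC' m ε _⟩

/-- **An enhanced state over an all-`1` resolution is `embU'` of the pull-back of its pull-back.**
[folklore] -/
theorem embU_pullA_pullU' (t : (G.antiBigon m ε).EnhancedState)
    (ht : t.state (G.fC' m ε) = true ∧ t.state (G.gC' m ε) = true) :
    embU' (pullA' (pullU' t ht) (pullU_fC_gC' t ht)) = t := by
  have hst : t.state = G.stU' m ε (G.oldOf' m ε t.state) :=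
    (G.state_eq_of_fC_gC' m ε t.state).2.2.1 ht.1 ht.2
  set x := pullA' (pullU' t ht) (pullU_fC_gC' t ht) with hx
  have hσ : G.oldOf' m ε x.1.state = G.oldOf' m ε t.state := by
    rw [hx, pullA_state', pullU_state', oldOf_stO', oldOf_stA']
  refine EnhancedState.ext' (by rw [embU_state', hσ, ← hst]) (funext fun u ↦ ?_)
  have hcG : x.1.label (G.cG' m ε) = t.label (G.cG' m ε) := by
    rw [hx, pullA_label_of_not_inO' _ _ (G.not_inO_cG' m ε),
      pullU_label_of_not_inO' _ _ (G.not_inO_cG' m ε)]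
  by_cases hu : G.InO' m ε u
  · rw [embU_label_of_inO' x hu, hcG]
    apply t.label_eq_of_circleOf_eq
    rw [hst, circleOf_stU_cG']
    exact (G.circleOf_stU_eq_aG_of_inO' m ε _ hu).symm
  · rw [embU_label_of_not_inO' x hu, hx, pullA_label_of_not_inO' _ _ hu, pullU_label_of_not_inO' _ _ hu]

/-! ## The bijection with the five sectors -/

variable (G m ε)

/-- **The basis of the complex of the antiBigon adapted to the cancellation**: the map from
`A ⊕ P ⊕ Q ⊕ U ⊕ C(D)` (the `A`-sector four times and the enhanced states of `G`) to the
enhanced states of the antiBigon. Khovanov (2000), §5.3; Bar-Natan (2002), §4.3. [cite: Khovanov2000, §5.3] -/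
def embSum' : G.XA' m ε ⊕ (G.XA' m ε ⊕ (G.XA' m ε ⊕ (G.XA' m ε ⊕ G.EnhancedState))) →
    (G.antiBigon m ε).EnhancedState :=
  Sum.elim (fun x ↦ x.1) (Sum.elim (fun x ↦ embO' x true) (Sum.elim (fun x ↦ embO' x false)
    (Sum.elim embU' (antiD m ε))))

/-- `embSum'` on the sector `A`. [folklore] -/
@[simp] theorem embSum_inl' (x : G.XA' m ε) : G.embSum' m ε (.inl x) = x.1 := rfl
/-- `embSum'` on the sector `P`. [folklore] -/
@[simp] theorem embSum_inr_inl' (x : G.XA' m ε) : G.embSum' m ε (.inr (.inl x)) = embO' x true := rfl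
/-- `embSum'` on the sector `Q`. [folklore] -/
@[simp] theorem embSum_inr_inr_inl' (x : G.XA' m ε) :
    G.embSum' m ε (.inr (.inr (.inl x))) = embO' x false := rfl
/-- `embSum'` on the sector `U`. [folklore] -/
@[simp] theorem embSum_inr_inr_inr_inl' (x : G.XA' m ε) :
    G.embSum' m ε (.inr (.inr (.inr (.inl x)))) = embU' x := rfl
/-- `embSum'` on the sector `D`. [folklore] -/
@[simp] theorem embSum_inr_inr_inr_inr' (s : G.EnhancedState) :
    G.embSum' m ε (.inr (.inr (.inr (.inr s)))) = antiD m ε s := rfl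

/-- The smoothings of `f`, `g` and the label of `sideM'` of an embedded basis vector, by sector.
[folklore] -/
theorem embSum_sig' (a : G.XA' m ε ⊕ (G.XA' m ε ⊕ (G.XA' m ε ⊕ (G.XA' m ε ⊕ G.EnhancedState)))) :
    ((G.embSum' m ε a).state (G.fC' m ε), (G.embSum' m ε a).state (G.gC' m ε)) =
      Sum.elim (fun _ ↦ (false, false)) (Sum.elim (fun _ ↦ (true, false))
        (Sum.elim (fun _ ↦ (true, false)) (Sum.elim (fun _ ↦ (true, true))
          (fun _ ↦ (false, true))))) a := by
  rcases a with x | x | x | x | s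
  · exact Prod.ext x.2.1 x.2.2
  · simp only [embSum_inr_inl', embO_state', Sum.elim_inr, Sum.elim_inl]
    exact Prod.ext (G.stO_fC' m ε _) (G.stO_gC' m ε _)
  · simp only [embSum_inr_inr_inl', embO_state', Sum.elim_inr, Sum.elim_inl]
    exact Prod.ext (G.stO_fC' m ε _) (G.stO_gC' m ε _)
  · simp only [embSum_inr_inr_inr_inl', embU_state', Sum.elim_inr, Sum.elim_inl]
    exact Prod.ext (G.stU_fC' m ε _) (G.stU_gC' m ε _)
  · simp only [embSum_inr_inr_inr_inr', antiD_state, Sum.elim_inr]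
    exact Prod.ext (G.stD_fC' m ε _) (G.stD_gC' m ε _)

/-- `embSum'` is injective. [folklore] -/
theorem embSum_injective' : Injective (G.embSum' m ε) := by
  intro a b h
  have hsig := G.embSum_sig' m ε a
  rw [h, embSum_sig'] at hsig
  rcases a with x | x | x | x | s <;> rcases b with y | y | y | y | s' <;>
    simp only [Sum.elim_inl, Sum.elim_inr, Prod.mk.injEq, Bool.true_eq_false, Bool.false_eq_true,
      and_false, and_true, and_self] at hsig
  · exact congrArg Sum.inl (Subtype.ext h)
  · exact congrArg (fun y ↦ Sum.inr (Sum.inl y)) (embO_injective' true h)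
  · have := congrArg (fun t : (G.antiBigon m ε).EnhancedState ↦ t.label (G.sideM' m ε)) h
    simp at this
  · have := congrArg (fun t : (G.antiBigon m ε).EnhancedState ↦ t.label (G.sideM' m ε)) h
    simp at this
  · exact congrArg (fun y ↦ Sum.inr (Sum.inr (Sum.inl y))) (embO_injective' false h)
  · exact congrArg (fun y ↦ Sum.inr (Sum.inr (Sum.inr (Sum.inl y)))) (embU_injective' h)
  · exact congrArg (fun y ↦ Sum.inr (Sum.inr (Sum.inr (Sum.inr y)))) (antiD_injective m ε h)

/-- `embSum'` is surjective: **every enhanced state of the antiBigon lies in one of the five sectors.**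
[folklore] -/
theorem embSum_surjective' : Surjective (G.embSum' m ε) := by
  intro t
  cases hf : t.state (G.fC' m ε) <;> cases hg : t.state (G.gC' m ε)
  · exact ⟨.inl ⟨t, hf, hg⟩, rfl⟩
  · obtain ⟨s, -, hs⟩ := eq_antiD_of_state_eq m ε t ((G.state_eq_of_fC_gC' m ε t.state).2.2.2 hf hg)
    exact ⟨.inr (.inr (.inr (.inr s))), hs⟩
  · have key := embO_pullA' t ⟨hf, hg⟩
    cases ho : t.label (G.sideM' m ε)
    · refine ⟨.inr (.inr (.inl (pullA' t ⟨hf, hg⟩))), ?_⟩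
      rw [ho] at key
      exact key
    · refine ⟨.inr (.inl (pullA' t ⟨hf, hg⟩)), ?_⟩
      rw [ho] at key
      exact key
  · exact ⟨.inr (.inr (.inr (.inl (pullA' (pullU' t ⟨hf, hg⟩) (pullU_fC_gC' t ⟨hf, hg⟩))))),
      embU_pullA_pullU' t ⟨hf, hg⟩⟩

/-- **The bijection of the five sectors with the enhanced states of the antiBigon.**
Khovanov (2000), §5.3; Bar-Natan (2002), §4.3. [cite: Khovanov2000, §5.3] -/
def antiESEquiv : G.XA' m ε ⊕ (G.XA' m ε ⊕ (G.XA' m ε ⊕ (G.XA' m ε ⊕ G.EnhancedState))) ≃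
    (G.antiBigon m ε).EnhancedState :=
  Equiv.ofBijective (G.embSum' m ε) ⟨G.embSum_injective' m ε, G.embSum_surjective' m ε⟩

/-- `antiESEquiv` is `embSum'`. [folklore] -/
@[simp] theorem antiESEquiv_apply
    (a : G.XA' m ε ⊕ (G.XA' m ε ⊕ (G.XA' m ε ⊕ (G.XA' m ε ⊕ G.EnhancedState)))) :
    G.antiESEquiv m ε a = G.embSum' m ε a := rfl

/-! ## The blocks of the differential -/

variable {G m ε}

section Ring

variable {R : Type} [CommRing R] (hR tR : R)

/-- Old chords never change the label of the small circle: **an incidence number between two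
states over resolutions with the small circle that label it differently vanishes** (the block
`Q → P`). Khovanov (2000), §5.3 (`d` preserves the decomposition `V ⊗ 1 ⊕ V ⊗ X` of
`C(D ⊔ O)`). [cite: Khovanov2000, §5.3] -/
theorem incidence_eq_zero_of_label_sideM_ne' {t t' : (G.antiBigon m ε).EnhancedState} {σ σ' : G.State}
    (ht : t.state = G.stO' m ε σ) (ht' : t'.state = G.stO' m ε σ')
    (hl : t.label (G.sideM' m ε) ≠ t'.label (G.sideM' m ε)) :
    (G.antiBigon m ε).incidence R hR tR t t' = 0 := by
  by_contra hne
  obtain ⟨j, hj, hs⟩ := exists_of_incidence_ne_zero hne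
  -- the flipped chord is an old one
  obtain ⟨i, rfl⟩ : ∃ i, j = G.oldC' m ε i := by
    rcases G.eq_oldC_or_bX_or_bY' m ε j with ⟨i, rfl⟩ | rfl | rfl
    · exact ⟨i, rfl⟩
    · exfalso
      have h1 := congrFun hs (G.bX' m ε)
      rw [Function.update_self, ht'] at h1
      rw [ht] at hj
      unfold stO' at h1 hj
      rw [antiState_bX] at h1 hj
      rw [hj] at h1
      exact Bool.noConfusion h1
    · exfalso
      have h1 := congrFun hs (G.bY' m ε)
      rw [Function.update_self, ht'] at h1
      rw [ht] at hj
      unfold stO' at h1 hj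
      rw [antiState_bY] at h1 hj
      rw [hj] at h1
      exact Bool.noConfusion h1
  have hσ' : σ' = Function.update σ i true := by
    rw [ht, ht'] at hs
    unfold stO' at hs
    rw [update_antiState_oldC] at hs
    exact (G.antiState_inj m ε hs).1
  -- in both states the small circle is off the circle of the first strand of `i`
  have hoff : ∀ τ : G.State, (G.antiBigon m ε).circleOf (G.stO' m ε τ) (G.sideM' m ε) ≠
      (G.antiBigon m ε).circleOf (G.stO' m ε τ)
        ((G.antiBigon m ε).arcIn ((G.antiBigon m ε).overPos (G.oldC' m ε i))) := by
    intro τ h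
    rw [overPos_antiBigon_oldC] at h
    exact G.not_inO_arcIn_bEmb' m ε _ ((G.circleOf_stO_eq_iff' m ε τ _).1 h.symm)
  rw [(G.antiBigon m ε).incidence_of_flip R hR tR hj hs] at hne
  by_cases hm : (G.antiBigon m ε).IsMergeAt t.state (G.oldC' m ε i)
  · rw [if_pos hm] at hne
    by_cases hc : ∀ c, (G.antiBigon m ε).circleOf t'.state c ≠
        (G.antiBigon m ε).circleOf t'.state
          ((G.antiBigon m ε).arcIn ((G.antiBigon m ε).overPos (G.oldC' m ε i))) →
        t'.label c = t.label c
    · exact hl (hc _ (by rw [ht', hσ']; exact hoff _)).symm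
    · rw [if_neg hc] at hne
      exact hne rfl
  · rw [if_neg hm] at hne
    by_cases hsp : (G.antiBigon m ε).IsSplitAt t.state (G.oldC' m ε i)
    · rw [if_pos hsp] at hne
      by_cases hc : ∀ c, (G.antiBigon m ε).circleOf t.state c ≠
          (G.antiBigon m ε).circleOf t.state
            ((G.antiBigon m ε).arcIn ((G.antiBigon m ε).overPos (G.oldC' m ε i))) →
          t'.label c = t.label c
      · exact hl (hc _ (by rw [ht]; exact hoff _)).symm
      · rw [if_neg hc] at hne
        exact hne rfl
    · rw [if_neg hsp] at hne
      exact hne rfl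

/-- **The block `A → P` is the identity up to the Koszul sign.** For `x, x'` in the `A`-sector,
`⟨d x, embO' x' X⟩ = [x = x'] · edgeSign`: across the split at `f` the component of `Δ` on
`(-) ⊗ X` is the identity (`Δ 1 = 1 ⊗ X + …`, `Δ X = X ⊗ X + …`). Khovanov (2000), §5.3, (5);
Bar-Natan (2002), §4.3. [cite: Khovanov2000, §5.3] -/
theorem incidence_embA_embP' (x x' : G.XA' m ε) :
    (G.antiBigon m ε).incidence R hR tR x.1 (embO' x' true) =
      if x = x' then (edgeSign (G.stA' m ε (G.oldOf' m ε x.1.state)) (G.fC' m ε) : R) else 0 := by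
  by_cases hss : G.oldOf' m ε x.1.state = G.oldOf' m ε x'.1.state
  · -- same old state: the entry of the comultiplication table
    have hx : x.1.state = G.stA' m ε (G.oldOf' m ε x'.1.state) := by rw [← hss]; exact x.state_eq
    have key := (G.isSplitAt_stA' m ε (G.oldOf' m ε x'.1.state)).incidence_push' hR tR x.1 hx
      (x'.1.lab x'.state_eq)
      (if G.InO' m ε (G.aF' m ε) then true else x'.1.label (G.aF' m ε))
      (if G.InO' m ε (G.aF' m ε) then x'.1.label (G.aF' m ε) else true)
    change (G.antiBigon m ε).incidence R hR tR x.1 (embO' x' true) = _ at key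
    rw [key]
    simp only [EnhancedState.lab_val]
    change (if ∀ u, (G.antiBigon m ε).circleOf (G.stA' m ε (G.oldOf' m ε x'.1.state)) u ≠
        (G.antiBigon m ε).circleOf (G.stA' m ε (G.oldOf' m ε x'.1.state)) (G.aF' m ε) →
        x'.1.label u = x.1.label u then
      (edgeSign (G.stA' m ε (G.oldOf' m ε x'.1.state)) (G.fC' m ε) : R) *
        splitCoeff R hR tR (x.1.label (G.aF' m ε))
          (if G.InO' m ε (G.aF' m ε) then true else x'.1.label (G.aF' m ε))
          (if G.InO' m ε (G.aF' m ε) then x'.1.label (G.aF' m ε) else true) else 0) = _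
    have tab : splitCoeff R hR tR (x.1.label (G.aF' m ε))
        (if G.InO' m ε (G.aF' m ε) then true else x'.1.label (G.aF' m ε))
        (if G.InO' m ε (G.aF' m ε) then x'.1.label (G.aF' m ε) else true) =
        if x'.1.label (G.aF' m ε) = x.1.label (G.aF' m ε) then 1 else 0 := by
      rw [← splitCoeff_o_true hR tR (x.1.label (G.aF' m ε)) (x'.1.label (G.aF' m ε))
        (decide (G.InO' m ε (G.aF' m ε)))]
      by_cases h : G.InO' m ε (G.aF' m ε) <;> simp [h]
    rw [tab, hss]
    by_cases hxx : x = x'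
    · subst hxx
      rw [if_pos (fun u _ ↦ rfl), if_pos rfl, if_pos rfl, mul_one]
    · rw [if_neg hxx]
      split_ifs with hC hℓ
      · -- labels agree off and on the split circle: `x = x'`
        exfalso
        apply hxx
        apply Subtype.ext
        refine EnhancedState.ext' (hx.trans x'.state_eq.symm) (funext fun u ↦ ?_)
        by_cases hu : (G.antiBigon m ε).circleOf (G.stA' m ε (G.oldOf' m ε x'.1.state)) u =
            (G.antiBigon m ε).circleOf (G.stA' m ε (G.oldOf' m ε x'.1.state)) (G.aF' m ε)
        · have hu1 : (G.antiBigon m ε).circleOf x.1.state u =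
              (G.antiBigon m ε).circleOf x.1.state (G.aF' m ε) := by rw [hx]; exact hu
          have hu2 : (G.antiBigon m ε).circleOf x'.1.state u =
              (G.antiBigon m ε).circleOf x'.1.state (G.aF' m ε) := by rw [x'.state_eq]; exact hu
          rw [x.1.label_eq_of_circleOf_eq hu1, x'.1.label_eq_of_circleOf_eq hu2, hℓ]
        · exact (hC u hu).symm
      · rw [mul_zero]
      · rfl
  · -- different old states: no edge
    rw [if_neg (fun h ↦ hss (by rw [h]))]
    apply (G.antiBigon m ε).incidence_of_not_flip R hR tR
    rintro ⟨j, -, hs⟩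
    apply hss
    rw [embO_state', x.state_eq] at hs
    have h1 : j = G.fC' m ε := by
      by_contra hne
      have := congrFun hs (G.fC' m ε)
      rw [Function.update_of_ne (fun h ↦ hne h.symm), stO_fC', stA_fC'] at this
      exact Bool.noConfusion this
    subst h1
    rw [update_stA_fC'] at hs
    exact ((G.antiState_inj m ε hs).1).symm

/-- The labels of `embO' x o` at the two local strands of `g`: `o` on the strand on the small
circle, the label of `x` at the strand off it on the other. [folklore] -/
theorem embO_label_aG_bG' (x : G.XA' m ε) (o : Bool) :
    ((embO' x o).label (G.aG' m ε), (embO' x o).label (G.bG' m ε)) =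
      if G.InO' m ε (G.aG' m ε) then (o, x.1.label (G.cG' m ε))
      else (x.1.label (G.cG' m ε), o) := by
  unfold cG'
  rcases G.inO_aG_bG' m ε with ⟨ha, hb⟩ | ⟨ha, hb⟩
  · rw [if_neg ha, if_neg ha, embO_label_of_not_inO' x o ha, embO_label_of_inO' x o hb]
  · rw [if_pos ha, if_pos ha, embO_label_of_inO' x o ha, embO_label_of_not_inO' x o hb]

/-- **The block `Q → U` is the identity up to the Koszul sign.** For `x, x'` in the `A`-sector,
`⟨d (embO' x 1), embU' x'⟩ = [x = x'] · edgeSign`: across the merge at `g` the multiplication by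
the label `1` of the small circle is the identity. Khovanov (2000), §5.3, (4); Bar-Natan (2002),
§4.3. [cite: Khovanov2000, §5.3] -/
theorem incidence_embQ_embU' (x x' : G.XA' m ε) :
    (G.antiBigon m ε).incidence R hR tR (embO' x false) (embU' x') =
      if x = x' then (edgeSign (G.stO' m ε (G.oldOf' m ε x.1.state)) (G.gC' m ε) : R) else 0 := by
  by_cases hss : G.oldOf' m ε x.1.state = G.oldOf' m ε x'.1.state
  · have hx : (embO' x false).state = G.stO' m ε (G.oldOf' m ε x'.1.state) := by
      rw [← hss]; exact embO_state' x false
    have key := (G.isMergeAt_stO' m ε (G.oldOf' m ε x'.1.state)).incidence_push' hR tR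
      (embO' x false) hx ((embO' x' false).lab (embO_state' x' false)) (x'.1.label (G.cG' m ε))
    change (G.antiBigon m ε).incidence R hR tR (embO' x false) (embU' x') = _ at key
    rw [update_stO_gC'] at key
    rw [key]
    simp only [EnhancedState.lab_val]
    change (if ∀ u, (G.antiBigon m ε).circleOf (G.stU' m ε (G.oldOf' m ε x'.1.state)) u ≠
        (G.antiBigon m ε).circleOf (G.stU' m ε (G.oldOf' m ε x'.1.state)) (G.aG' m ε) →
        (embO' x' false).label u = (embO' x false).label u then
      (edgeSign (G.stO' m ε (G.oldOf' m ε x'.1.state)) (G.gC' m ε) : R) *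
        mergeCoeff R hR tR ((embO' x false).label (G.aG' m ε)) ((embO' x false).label (G.bG' m ε))
          (x'.1.label (G.cG' m ε)) else 0) = _
    have tab : mergeCoeff R hR tR ((embO' x false).label (G.aG' m ε))
        ((embO' x false).label (G.bG' m ε)) (x'.1.label (G.cG' m ε)) =
        if x'.1.label (G.cG' m ε) = x.1.label (G.cG' m ε) then 1 else 0 := by
      have hab := embO_label_aG_bG' x false
      rw [← mergeCoeff_o_false hR tR (x.1.label (G.cG' m ε)) (x'.1.label (G.cG' m ε))
        (decide (G.InO' m ε (G.aG' m ε)))]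
      by_cases h : G.InO' m ε (G.aG' m ε)
      · rw [if_pos h] at hab
        simp only [Prod.mk.injEq] at hab
        rw [hab.1, hab.2]
        simp [h]
      · rw [if_neg h] at hab
        simp only [Prod.mk.injEq] at hab
        rw [hab.1, hab.2]
        simp [h]
    rw [tab, hss]
    by_cases hxx : x = x'
    · subst hxx
      rw [if_pos (fun u _ ↦ rfl), if_pos rfl, if_pos rfl, mul_one]
    · rw [if_neg hxx]
      split_ifs with hC hℓ
      · -- labels agree everywhere: `x = x'`
        exfalso
        apply hxx
        apply Subtype.ext
        refine EnhancedState.ext'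
          (x.state_eq.trans ((congrArg (G.stA' m ε) hss).trans x'.state_eq.symm))
          (funext fun u ↦ ?_)
        by_cases hu : G.InO' m ε u
        · -- on `O`: the labels of `x`, `x'` are those at `cF'`, which is off `O`
          have e1 : x.1.label u = x.1.label (G.cF' m ε) := x.1.label_eq_of_circleOf_eq (by
            rw [x.state_eq, circleOf_stA_cF']; exact G.circleOf_stA_eq_aF_of_inO' m ε _ hu)
          have e2 : x'.1.label u = x'.1.label (G.cF' m ε) := x'.1.label_eq_of_circleOf_eq (by
            rw [x'.state_eq, circleOf_stA_cF']; exact G.circleOf_stA_eq_aF_of_inO' m ε _ hu)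
          rw [e1, e2]
          by_cases hc : (G.antiBigon m ε).circleOf (G.stU' m ε (G.oldOf' m ε x'.1.state)) (G.cF' m ε) =
              (G.antiBigon m ε).circleOf (G.stU' m ε (G.oldOf' m ε x'.1.state)) (G.aG' m ε)
          · -- `cF'` on the merged circle, off `O`: same `stA'`-circle as `cG'`
            have r1 : ∀ y : G.XA' m ε, G.oldOf' m ε y.1.state = G.oldOf' m ε x'.1.state →
                y.1.label (G.cF' m ε) = y.1.label (G.cG' m ε) := by
              intro y hy
              rw [← embU_label_of_not_inO' y (G.not_inO_cF' m ε), embU_label', if_pos]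
              rw [hy]; exact hc
            rw [r1 x hss, r1 x' rfl, hℓ]
          · have := hC _ hc
            rwa [embO_label_of_not_inO' x' false (G.not_inO_cF' m ε),
              embO_label_of_not_inO' x false (G.not_inO_cF' m ε), eq_comm] at this
        · by_cases hc : (G.antiBigon m ε).circleOf (G.stU' m ε (G.oldOf' m ε x'.1.state)) u =
              (G.antiBigon m ε).circleOf (G.stU' m ε (G.oldOf' m ε x'.1.state)) (G.aG' m ε)
          · have r1 : ∀ y : G.XA' m ε, G.oldOf' m ε y.1.state = G.oldOf' m ε x'.1.state →
                y.1.label u = y.1.label (G.cG' m ε) := by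
              intro y hy
              rw [← embU_label_of_not_inO' y hu, embU_label', if_pos]
              rw [hy]; exact hc
            rw [r1 x hss, r1 x' rfl, hℓ]
          · have := hC _ hc
            rwa [embO_label_of_not_inO' x' false hu, embO_label_of_not_inO' x false hu, eq_comm] at this
      · rw [mul_zero]
      · rfl
  · -- different old states: no edge
    rw [if_neg (fun h ↦ hss (by rw [h]))]
    apply (G.antiBigon m ε).incidence_of_not_flip R hR tR
    rintro ⟨j, -, hs⟩
    apply hss
    rw [embU_state', embO_state'] at hs
    have h1 : j = G.gC' m ε := by
      by_contra hne
      have := congrFun hs (G.gC' m ε)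
      rw [Function.update_of_ne (fun h ↦ hne h.symm), stU_gC', stO_gC'] at this
      exact Bool.noConfusion this
    subst h1
    rw [update_stO_gC'] at hs
    exact ((G.antiState_inj m ε hs).1).symm

/-- The block `A → P` has nonzero diagonal (over `ℤ`): used for the degrees. [folklore] -/
theorem incidence_embA_embP_self_ne_zero' (x : G.XA' m ε) :
    (G.antiBigon m ε).incidence ℤ 0 0 x.1 (embO' x true) ≠ 0 := by
  rw [incidence_embA_embP', if_pos rfl]
  unfold edgeSign
  simp

/-- The block `Q → U` has nonzero diagonal (over `ℤ`). [folklore] -/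
theorem incidence_embQ_embU_self_ne_zero' (x : G.XA' m ε) :
    (G.antiBigon m ε).incidence ℤ 0 0 (embO' x false) (embU' x) ≠ 0 := by
  rw [incidence_embQ_embU', if_pos rfl]
  unfold edgeSign
  simp

end Ring

end GaussDiagram

end Literature.Topology.FourManifolds
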